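import Mathlib
import HarnessLib
import Summits.NavierStokesRegularity.NavierStokesRegularity.Theorems.RellichScarTypeIBlowupProfile

/-!
# Route `LocalSineTubeDoor`, crux `LocalPointZoom` (stmt-NavierStokesRegularity-20017) —
# support file 5: frame data on unit cylinders about the slice `s = −1` (LOCAL Type I)

Cell ns-regularity-ideate, seat p6 (route-directed support, `--supports stmt-NavierStokesRegularity-20017`);
local version of the cell's `Cell.NsRegP1c.zoomFrame_data` (Sketch4/8A):

* `localZoomFrame_data` — in the zoom frame (half-zoom `v'` of class `Q(0,1)`, pressure `π'` with Seregin's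
  scaled pressure energies `cknD r 0 π' ≤ Ks` for `0 < r ≤ r₁`, zoom-in scales `λⱼ → 0⁺`, and the
  identification of the zooms `λⱼ • (v' ∘ λⱼ)` with `(s,y) ↦ (Rλⱼ/2ν) u(T + (Rλⱼ/2)² s/ν, x₀ + (Rλⱼ/2) y)`),
  for every `y` and all large `j`: on the unit parabolic cylinder about `(−½, y)` the zooms are (i)
  distributional solutions of the unit-viscosity system (zoom-out of the `Q(0,1)` class), (ii) bounded by
  `M√2/ν` — from the LOCAL ODE-rate Type I bound `‖u(t,x)‖√(ν(T−t)) ≤ M` on `B(x₀,ρ) × (T−ρ², T)`, into which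
  the unit cylinder zooms for large `j` (two extra thresholds `λⱼ < 2ρ/(R(‖y‖+2))`,
  `(Rλⱼ/2)²·2 < νρ²` compared with the global proof) —, (iii) with pressure `L^{3/2}` mass `≤ (‖y‖+2)² Ks`.

These are the hypotheses of Seregin–Šverák 2009 §2 (tree `NSBoundedHigherRegularityBounds_holds`) consumed by
the curl-convergence step.  WHAT THIS IS NOT: not a claim about Navier–Stokes regularity.
-/

noncomputable section

namespace Summit.NavierStokesRegularity.NavierStokesRegularity.Theorems.LocalSineTubeDoorLocalPointZoomData

open MeasureTheory Set Function Filter Topology TopologicalSpace Metric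
open Literature.Analysis Literature.Analysis.FluidPDE Literature.Analysis.FluidPDE.SereginSverak2009
open Summit.NavierStokesRegularity.NavierStokesRegularity.Theorems
open scoped NNReal ENNReal

/-- **(i)–(iii) eventually in `j`, LOCAL Type I**: on the unit cylinder about `(−½, y)` the zooms
`λⱼ • (v' ∘ λⱼ)` are distributional solutions (zoom-out of the `Q(0,1)` class), bounded by `M√2/ν` (the
local Type-I cylinder `B(x₀,ρ) × (T−ρ²,T)` contains the zoomed cylinder for large `j`), with pressure mass
`≤ (‖y‖+2)² Ks`. -/
theorem localZoomFrame_data {ν T : ℝ} (hν : 0 < ν) (hT : 0 < T) {u : ℝ → (EuclideanSpace ℝ (Fin 3)) → (EuclideanSpace ℝ (Fin 3))} {x₀ : (EuclideanSpace ℝ (Fin 3))} {ρ M : ℝ}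
    (hρ : 0 < ρ)
    (hM : ∀ t ∈ Ico 0 T, T - ρ ^ 2 < t → ∀ x ∈ ball x₀ ρ, ‖u t x‖ * Real.sqrt (ν * (T - t)) ≤ M)
    {R : ℝ} (hR : 0 < R) {v' : ℝ → (EuclideanSpace ℝ (Fin 3)) → (EuclideanSpace ℝ (Fin 3))} {π' : ℝ → (EuclideanSpace ℝ (Fin 3)) → ℝ}
    (hball1 : IsSuitableWeakSolutionInBall 1 0 v' π') {lam : ℕ → ℝ} (hlam : ∀ j, 0 < lam j)
    (hlam0 : Tendsto lam atTop (𝓝 0)) {Ks : ℝ≥0} {r₁ : ℝ} (hr₁ : 0 < r₁) (hr₁1 : r₁ ≤ 1)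
    (hKs : ∀ r ∈ Ioc (0 : ℝ) r₁, cknD r (0 : ℝ × (EuclideanSpace ℝ (Fin 3))) π' ≤ Ks)
    (hpt : ∀ (j : ℕ) (s : ℝ) (y : (EuclideanSpace ℝ (Fin 3))), ((lam j) • stPull ((lam j) ^ 2) (lam j) (0 : ℝ) (0 : (EuclideanSpace ℝ (Fin 3))) v') s y =
      ((R * (lam j / 2)) / ν) • u (T + (R * (lam j / 2)) ^ 2 * s / ν) (x₀ + (R * (lam j / 2)) • y)) (y : (EuclideanSpace ℝ (Fin 3))) :
    ∃ J : ℕ, ∀ j, J ≤ j →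
      (R * (lam j / 2)) ^ 2 * 2 < ν * T ∧
      IsDistributionalNSSolutionOn (parabolicCylinderOpens 1 ((-(1 / 2) : ℝ), y)) 1 0 ((lam j) • stPull ((lam j) ^ 2) (lam j) (0 : ℝ) (0 : (EuclideanSpace ℝ (Fin 3))) v') ((lam j) ^ 2 • stPull ((lam j) ^ 2) (lam j) (0 : ℝ) (0 : (EuclideanSpace ℝ (Fin 3))) π') ∧
      (∀ᵐ w ∂(volume.restrict (parabolicCylinder 1 ((-(1 / 2) : ℝ), y))),
        ‖((lam j) • stPull ((lam j) ^ 2) (lam j) (0 : ℝ) (0 : (EuclideanSpace ℝ (Fin 3))) v') w.1 w.2‖ ≤ M * Real.sqrt 2 / ν) ∧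
      ∫⁻ w in parabolicCylinder 1 ((-(1 / 2) : ℝ), y), ‖((lam j) ^ 2 • stPull ((lam j) ^ 2) (lam j) (0 : ℝ) (0 : (EuclideanSpace ℝ (Fin 3))) π') w.1 w.2‖ₑ ^ (3 / 2 : ℝ) ≤
        ((((‖y‖ + 2) ^ 2).toNNReal * Ks : ℝ≥0) : ℝ≥0∞) := by
  have hΛpos : ∀ j, 0 < (R * (lam j / 2)) := fun j => mul_pos hR (half_pos (hlam j))
  have hΛ0 : Tendsto (fun j => (R * (lam j / 2))) atTop (𝓝 0) := by
    simpa using (hlam0.div_const 2).const_mul R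
  have hZpt : ∀ (j : ℕ) (s : ℝ) (y' : (EuclideanSpace ℝ (Fin 3))),
      ((lam j) • stPull ((lam j) ^ 2) (lam j) (0 : ℝ) (0 : (EuclideanSpace ℝ (Fin 3))) v') s y' = ((R * (lam j / 2)) / ν) • u (T + (R * (lam j / 2)) ^ 2 * s / ν) (x₀ + (R * (lam j / 2)) • y') :=
    hpt
  -- the thresholds in `j`
  set a : ℝ := ‖y‖ + 2 with ha_def
  have ha : 0 < a := by positivity
  have ha2 : 2 ≤ a := by rw [ha_def]; linarith [norm_nonneg y]
  have hevA : ∀ᶠ j in atTop, lam j < r₁ / a := hlam0 (Iio_mem_nhds (by positivity))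
  have hevC : ∀ᶠ j in atTop, (R * (lam j / 2)) ^ 2 * 2 < ν * T := by
    have h : Tendsto (fun j => (R * (lam j / 2)) ^ 2 * 2) atTop (𝓝 0) := by
      simpa using (hΛ0.pow 2).mul_const 2
    exact h (Iio_mem_nhds (by positivity))
  -- LOCAL Type I: the unit cylinder about `(−½, y)` zooms into `B(x₀, ρ) × (T − ρ², T)` eventually
  have hevB : ∀ᶠ j in atTop, lam j < 2 * ρ / (R * a) := hlam0 (Iio_mem_nhds (by positivity))
  have hevD : ∀ᶠ j in atTop, (R * (lam j / 2)) ^ 2 * 2 < ν * ρ ^ 2 := by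
    have h : Tendsto (fun j => (R * (lam j / 2)) ^ 2 * 2) atTop (𝓝 0) := by
      simpa using (hΛ0.pow 2).mul_const 2
    exact h (Iio_mem_nhds (by positivity))
  obtain ⟨J, hJ⟩ := eventually_atTop.1 ((hevA.and hevC).and (hevB.and hevD))
  have hlamA : ∀ j, J ≤ j → lam j * a ≤ r₁ := fun j hj =>
    ((lt_div_iff₀ ha).1 (hJ j hj).1.1).le
  have hlam1 : ∀ j, J ≤ j → lam j * a ≤ 1 := fun j hj => (hlamA j hj).trans hr₁1
  have hlamhalf : ∀ j, J ≤ j → lam j ≤ 1 / 2 := by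
    intro j hj
    have h := hlam1 j hj
    have hl := hlam j
    rw [le_div_iff₀ (by norm_num : (0 : ℝ) < 2)]
    nlinarith
  have hmemQ : ∀ {r : ℝ} {w : ℝ × (EuclideanSpace ℝ (Fin 3))},
      w ∈ parabolicCylinder r ((-(1 / 2) : ℝ), y) ↔
        (-(1 / 2) - r ^ 2 < w.1 ∧ w.1 < -(1 / 2)) ∧ dist w.2 y < r := by
    intro r w
    simp only [parabolicCylinder, mem_prod, mem_Ioo, mem_ball]
  -- physical times of the zoom on the unit cylinder lie in `[0, T)`
  have htime : ∀ j, J ≤ j → ∀ s : ℝ, -(3 / 2) < s → s < -(1 / 2) →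
      T + (R * (lam j / 2)) ^ 2 * s / ν ∈ Ico 0 T := by
    intro j hj s hs1 hs2
    have hC := (hJ j hj).1.2
    have hΛ2 : 0 < (R * (lam j / 2)) ^ 2 := pow_pos (hΛpos j) 2
    refine ⟨?_, ?_⟩
    · have key : 0 ≤ ν * T + (R * (lam j / 2)) ^ 2 * s := by nlinarith
      have e : T + (R * (lam j / 2)) ^ 2 * s / ν = (ν * T + (R * (lam j / 2)) ^ 2 * s) / ν := by
        field_simp
      rw [e]
      exact div_nonneg key hν.le
    · have : (R * (lam j / 2)) ^ 2 * s / ν < 0 := div_neg_of_neg_of_pos (by nlinarith) hν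
      linarith
  -- physical points of the zoom on the unit cylinder lie in the local Type I cylinder
  have htimeρ : ∀ j, J ≤ j → ∀ s : ℝ, -(3 / 2) < s → s < -(1 / 2) →
      T - ρ ^ 2 < T + (R * (lam j / 2)) ^ 2 * s / ν := by
    intro j hj s hs1 hs2
    have hD := (hJ j hj).2.2
    have hΛ2 : 0 < (R * (lam j / 2)) ^ 2 := pow_pos (hΛpos j) 2
    have key : (R * (lam j / 2)) ^ 2 * (-s) < ν * ρ ^ 2 := by nlinarith
    have e : (R * (lam j / 2)) ^ 2 * s / ν = -((R * (lam j / 2)) ^ 2 * (-s) / ν) := by ring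
    rw [e]
    have h2 : (R * (lam j / 2)) ^ 2 * (-s) / ν < ρ ^ 2 := by
      rw [div_lt_iff₀ hν]; linarith
    linarith
  have hspaceρ : ∀ j, J ≤ j → ∀ w' : (EuclideanSpace ℝ (Fin 3)), dist w' y < 1 → x₀ + (R * (lam j / 2)) • w' ∈ ball x₀ ρ := by
    intro j hj w' hw'
    have hB := (hJ j hj).2.1
    rw [mem_ball, dist_eq_norm, add_sub_cancel_left, norm_smul, Real.norm_of_nonneg (hΛpos j).le]
    have hw1 : ‖w'‖ < a := by
      calc ‖w'‖ ≤ dist w' y + ‖y‖ := by simpa [dist_zero_right] using dist_triangle w' y 0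
        _ < 1 + ‖y‖ := by linarith
        _ < a := by rw [ha_def]; linarith
    have h3 : lam j * (R * a) < 2 * ρ := by rwa [lt_div_iff₀ (by positivity)] at hB
    calc R * (lam j / 2) * ‖w'‖ ≤ R * (lam j / 2) * a :=
          mul_le_mul_of_nonneg_left hw1.le (hΛpos j).le
      _ = lam j * (R * a) / 2 := by ring
      _ < ρ := by linarith
  refine ⟨J, fun j hj => ⟨(hJ j hj).1.2, ?_, ?_, ?_⟩⟩
  · -- (i) the distributional equations on `Q(z, 1)` (zoom-out of the `Q(0,1)` class)
    have hzo := hball1.zoomOut (hlam j)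
    have hle : parabolicCylinderOpens 1 ((-(1 / 2) : ℝ), y) ≤
        parabolicCylinderOpens (1 / lam j) (0 : ℝ × (EuclideanSpace ℝ (Fin 3))) := by
      intro w hw
      change w ∈ parabolicCylinder 1 ((-(1 / 2) : ℝ), y) at hw
      change w ∈ parabolicCylinder (1 / lam j) (0 : ℝ × (EuclideanSpace ℝ (Fin 3)))
      rw [hmemQ] at hw
      obtain ⟨⟨h1, h2⟩, h3⟩ := hw
      have hl := hlam j
      have hhalf := hlamhalf j hj
      have hinv : 2 ≤ 1 / lam j := by
        rw [le_div_iff₀ hl]; linarith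
      have h4 : (4 : ℝ) ≤ (1 / lam j) ^ 2 := by nlinarith [hinv]
      simp only [parabolicCylinder, mem_prod, mem_Ioo, mem_ball, Prod.fst_zero, Prod.snd_zero,
        zero_sub, dist_zero_right]
      refine ⟨⟨by linarith, by linarith⟩, ?_⟩
      have hy1 : ‖y‖ + 1 < 1 / lam j := by
        rw [lt_div_iff₀ hl]
        have h5 := hlam1 j hj
        rw [ha_def] at h5
        nlinarith
      calc ‖w.2‖ ≤ dist w.2 y + ‖y‖ := by
            simpa [dist_zero_right] using dist_triangle w.2 y 0
        _ < 1 + ‖y‖ := by linarith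
        _ < 1 / lam j := by linarith
    exact (IsSuitableWeakSolutionOn.mono_holds hzo.1 hle).distributional
  · -- (ii) the uniform bound from time-Type-I
    refine ae_restrict_of_forall_mem (isOpen_parabolicCylinder _ _).measurableSet fun w hw => ?_
    rw [hmemQ] at hw
    obtain ⟨⟨h1, h2⟩, h3⟩ := hw
    have hs1 : -(3 / 2) < w.1 := by linarith
    obtain ⟨ht0, htT⟩ := htime j hj w.1 hs1 h2
    rw [hZpt, norm_smul, Real.norm_of_nonneg (div_pos (hΛpos j) hν).le]
    have hMt := hM (T + (R * (lam j / 2)) ^ 2 * w.1 / ν) ⟨ht0, htT⟩ (htimeρ j hj w.1 hs1 h2)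
      (x₀ + (R * (lam j / 2)) • w.2) (hspaceρ j hj w.2 h3)
    have hνT : ν * (T - (T + (R * (lam j / 2)) ^ 2 * w.1 / ν)) = (R * (lam j / 2)) ^ 2 * (-w.1) := by
      field_simp; ring
    rw [hνT, Real.sqrt_mul (sq_nonneg _), Real.sqrt_sq (hΛpos j).le] at hMt
    have hsw : Real.sqrt (1 / 2) ≤ Real.sqrt (-w.1) := Real.sqrt_le_sqrt (by linarith)
    have hs2 : Real.sqrt (1 / 2) * Real.sqrt 2 = 1 := by
      rw [← Real.sqrt_mul (by norm_num)]; norm_num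
    have hu0 : 0 ≤ ‖u (T + (R * (lam j / 2)) ^ 2 * w.1 / ν) (x₀ + (R * (lam j / 2)) • w.2)‖ := norm_nonneg _
    have step : ‖u (T + (R * (lam j / 2)) ^ 2 * w.1 / ν) (x₀ + (R * (lam j / 2)) • w.2)‖ * ((R * (lam j / 2)) * Real.sqrt (1 / 2)) ≤ M :=
      le_trans (mul_le_mul_of_nonneg_left (mul_le_mul_of_nonneg_left hsw (hΛpos j).le) hu0) hMt
    rw [div_mul_eq_mul_div, div_le_div_iff_of_pos_right hν]
    calc (R * (lam j / 2)) * ‖u (T + (R * (lam j / 2)) ^ 2 * w.1 / ν) (x₀ + (R * (lam j / 2)) • w.2)‖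
        = ‖u (T + (R * (lam j / 2)) ^ 2 * w.1 / ν) (x₀ + (R * (lam j / 2)) • w.2)‖ * ((R * (lam j / 2)) * Real.sqrt (1 / 2)) *
            Real.sqrt 2 := by
          calc (R * (lam j / 2)) * ‖u (T + (R * (lam j / 2)) ^ 2 * w.1 / ν) (x₀ + (R * (lam j / 2)) • w.2)‖
              = (R * (lam j / 2)) * ‖u (T + (R * (lam j / 2)) ^ 2 * w.1 / ν) (x₀ + (R * (lam j / 2)) • w.2)‖ *
                  (Real.sqrt (1 / 2) * Real.sqrt 2) := by rw [hs2, mul_one]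
            _ = _ := by ring
      _ ≤ M * Real.sqrt 2 := by gcongr
  · -- (iii) the pressure mass on `Q(z, 1)`
    have hl := hlam j
    have hsubQ : parabolicCylinder (lam j * 1)
        (stAffine ((lam j) ^ 2) (lam j) (0 : ℝ) (0 : (EuclideanSpace ℝ (Fin 3))) ((-(1 / 2) : ℝ), y)) ⊆
        parabolicCylinder (lam j * a) (0 : ℝ × (EuclideanSpace ℝ (Fin 3))) := by
      intro w hw
      simp only [parabolicCylinder, stAffine, mem_prod, mem_Ioo, mem_ball, Prod.fst_zero,
        Prod.snd_zero, zero_add, zero_sub, dist_zero_right] at hw ⊢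
      obtain ⟨⟨h1, h2⟩, h3⟩ := hw
      have hl2 : 0 < lam j ^ 2 := pow_pos hl 2
      have ha4 : 4 ≤ a ^ 2 := by nlinarith
      have h4 : 4 * lam j ^ 2 ≤ (lam j * a) ^ 2 := by
        rw [mul_pow]; nlinarith [mul_le_mul_of_nonneg_left ha4 hl2.le]
      refine ⟨⟨by nlinarith, by nlinarith⟩, ?_⟩
      calc ‖w.2‖ ≤ dist w.2 ((lam j) • y) + ‖(lam j) • y‖ := by
            simpa [dist_zero_right] using dist_triangle w.2 ((lam j) • y) 0
        _ < lam j * 1 + lam j * ‖y‖ := by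
            rw [norm_smul, Real.norm_of_nonneg hl.le]; linarith
        _ < lam j * a := by rw [ha_def]; nlinarith
    have hρ : 0 < lam j * a := by positivity
    have hD : cknD (lam j * a) (0 : ℝ × (EuclideanSpace ℝ (Fin 3))) π' ≤ Ks := hKs (lam j * a) ⟨hρ, hlamA j hj⟩
    calc ∫⁻ w in parabolicCylinder 1 ((-(1 / 2) : ℝ), y), ‖((lam j) ^ 2 • stPull ((lam j) ^ 2) (lam j) (0 : ℝ) (0 : (EuclideanSpace ℝ (Fin 3))) π') w.1 w.2‖ₑ ^ (3 / 2 : ℝ)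
        = cknD 1 ((-(1 / 2) : ℝ), y) ((lam j) ^ 2 • stPull ((lam j) ^ 2) (lam j) (0 : ℝ) (0 : (EuclideanSpace ℝ (Fin 3))) π') := by
          rw [cknD, ENNReal.ofReal_one, one_pow, inv_one, one_mul]
      _ = cknD (lam j * 1) (stAffine ((lam j) ^ 2) (lam j) (0 : ℝ) (0 : (EuclideanSpace ℝ (Fin 3)))
            ((-(1 / 2) : ℝ), y)) π' := cknD_nsZoom hl one_pos _ _ _ _
      _ ≤ ENNReal.ofReal ((lam j * a) / (lam j * 1)) ^ 2 * cknD (lam j * a) (0 : ℝ × (EuclideanSpace ℝ (Fin 3))) π' :=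
          cknD_le_mul_of_subset hρ (by positivity) hsubQ π'
      _ ≤ ENNReal.ofReal (a ^ 2) * Ks := by
          rw [show lam j * a / (lam j * 1) = a by field_simp, ENNReal.ofReal_pow ha.le]
          gcongr
      _ = (((a ^ 2).toNNReal * Ks : ℝ≥0) : ℝ≥0∞) := by rw [ENNReal.coe_mul]; rfl

end Summit.NavierStokesRegularity.NavierStokesRegularity.Theorems.LocalSineTubeDoorLocalPointZoomData

end
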